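import Summits.QuantumFields.YangMills.Theorems.ToronValleyVolumeNearlyCommutingCeiling
import HarnessLib

/-!
# The THREE-letter commutator small ball, CEILING side: `Haar³{pairwise ‖[q_μ, q_ν]‖ ≤ t} ≤ C·t⁴` — no logarithm

Companion of the four-letter two-sided law ✓`ToronLog.haar_pi_nearlyCommuting_ge` (w2 g54) / ✓`NearlyCommutingCeiling.haar_pi_nearlyCommuting_le`
(fcl-p3 g43): for THREE letters `(C_μ) ∈ SU(2)³` the product Haar mass of the event «the unit quaternions pairwise commute up to `t`»
is at most `C·t⁴` for small `t` — exponent `4 = 2·2` and NO logarithm.  This is the zero-mode block of the σ-GLUED (swap) femto ring at a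
swap-central flat point (cone of commuting TRIPLES: `5` flat directions — common axis `2` + three radii — and `4` transversal directions of
weight `½`; width seat w2 g54's stratum census of `Hom(ℤ³ ⋊_σ ℤ, SU(2))`, memo `SWAP-STRATA-23802-w2g54.md`): pole `2`, multiplicity ONE, so the
swap side carries no `log β`, in contrast with the periodic side's `k = 4` block `≍ t⁶·log(1/t)` (pole `3`, multiplicity `2`).  It is the
CEILING (stiffness) direction that crux ⟨stmt-QuantumFields-24197⟩ `SwapVirialDeficit.SwapGluedStiffness` consumes at the zero-mode level; with a
Haar small ball for the slaved fourth leader it bounds the σ-twisted four-leader block by `C·s⁷`.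

Argument (verbatim the dyadic-shell argument of ✓`ToronValleyVolumeNearlyCommutingCeiling` with `Fin 3`/`Fin 2` and the SQUARE in place of the cube;
every `k`-agnostic lemma is reused BY NAME — ✓`coneMeasure_section_le`, ✓`coneMeasure_imBall_le`, ✓`exists_shell`, ✓`lintegral_shellSum_eq`,
✓`coneMeasure_shell_le`): in the ball model (✓`coneMeasure`, radial projection is Haar, ✓`measurePreserving_quatToSU2`) normalising letters only
enlarges commutators; distinguishing the letter with the largest `‖Im‖ =: m`, the other two lie in the section of cone mass `≤ min(1, c·4t²/m)`;
Fubini over the distinguished letter and the shells `2^{-(k+1)} < m ≤ 2^{-k}` (cone mass `≤ 16c·2^{-3k}`) give the GEOMETRIC series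
`Σ_k (c·4t²·2^{k+1})²·16c·2^{-3k} = 1024c³t⁴·Σ_k 2^{-k} ≤ 2048c³t⁴`, plus the core `16c·2^{-3(K+1)} ≤ 16c·t⁶` — no `K`-dependence, hence no log.
* §1 measurability and product form for `Fin 3`; §2 pull-back and splitting; §3 the shell bound with the square; §4 ★★ `haar_pi_nearlyCommuting_three_le`.
HONEST LABEL: a finite-dimensional Haar-volume lemma toward the fixed-`L` zero-mode factor of the swap-glued ring (prediction row of a DRAFT line);
nothing about ⟨24197⟩/⟨24497⟩ or any rung is proved; the Yang–Mills mass gap is NOT proved; no summit is proved by a line.  Seat ym-line-sfw-p2 g93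
(LEAD of unit sfw-p2, free hands; `--supports stmt-QuantumFields-24197`).  THEOREMS ONLY (0 `def`, 0 `sorry`), standard axioms.
References: [cite: Vanbaal2001]; [cite: Luscher1983, §2]; [folklore].
-/

set_option autoImplicit false

noncomputable section

open MeasureTheory Quaternion Set
open scoped Quaternion ENNReal BigOperators
open Literature.MathematicalPhysics.QuantumLattice
open Literature.MathematicalPhysics.QuantumFieldTheory (haarProbability)
open Summit.QuantumFields.YangMills.Theorems.SwapTwistDeficit.ToronLog
open Summit.QuantumFields.YangMills.Theorems.ToronValleyVolume.NearlyCommutingCeiling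

attribute [local instance] Literature.Analysis.FluidPDE.Tao2016.quatMeasurableSpace
  Literature.Analysis.FluidPDE.Tao2016.quatBorelSpace
  Literature.MathematicalPhysics.QuantumLattice.secondCountableTopology_su2

namespace Summit.QuantumFields.YangMills.Theorems.SwapVirialDeficit.NearlyCommutingThree

/-! ## §1 Measurability; the product form of the two-letter section event -/

/-- The three-letter nearly-commuting event is measurable. [folklore] -/
theorem measurableSet_nearlyCommuting_three (t : ℝ) :
    MeasurableSet {C : Fin 3 → (Matrix.specialUnitaryGroup (Fin 2) ℂ) |
      ∀ μ ν : Fin 3, ‖su2Quat (C μ) * su2Quat (C ν) - su2Quat (C ν) * su2Quat (C μ)‖ ≤ t} := by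
  have hq : ∀ μ : Fin 3, Measurable fun C : Fin 3 → (Matrix.specialUnitaryGroup (Fin 2) ℂ) => su2Quat (C μ) := fun μ =>
    Literature.MathematicalPhysics.QuantumFieldTheory.Balaban1983to89.T4HaarSU2Translate.measurable_su2Quat.comp
      (measurable_pi_apply μ)
  have h : ∀ μ ν : Fin 3, MeasurableSet
      {C : Fin 3 → (Matrix.specialUnitaryGroup (Fin 2) ℂ) | ‖su2Quat (C μ) * su2Quat (C ν) - su2Quat (C ν) * su2Quat (C μ)‖ ≤ t} := fun μ ν =>
    measurableSet_le (((hq μ).mul (hq ν)).sub ((hq ν).mul (hq μ))).norm measurable_const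
  have e : {C : Fin 3 → (Matrix.specialUnitaryGroup (Fin 2) ℂ) |
      ∀ μ ν : Fin 3, ‖su2Quat (C μ) * su2Quat (C ν) - su2Quat (C ν) * su2Quat (C μ)‖ ≤ t} = ⋂ μ : Fin 3, ⋂ ν : Fin 3,
      {C : Fin 3 → (Matrix.specialUnitaryGroup (Fin 2) ℂ) | ‖su2Quat (C μ) * su2Quat (C ν) - su2Quat (C ν) * su2Quat (C μ)‖ ≤ t} := by
    ext C
    simp
  rw [e]
  exact MeasurableSet.iInter fun μ => MeasurableSet.iInter fun ν => h μ ν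

/-- Letter-wise radial projection `ℍ³ → SU(2)³` maps the product cone measure to product Haar measure. [folklore] -/
theorem measurePreserving_proj_three :
    MeasurePreserving (fun (x : Fin 3 → ℍ) (μ : Fin 3) => quatToSU2 (x μ)) (Measure.pi fun _ : Fin 3 => coneMeasure)
      (Measure.pi fun _ : Fin 3 => haarProbability (Matrix.specialUnitaryGroup (Fin 2) ℂ)) :=
  measurePreserving_pi (fun _ : Fin 3 => coneMeasure) (fun _ : Fin 3 => haarProbability (Matrix.specialUnitaryGroup (Fin 2) ℂ))
    fun _ => measurePreserving_quatToSU2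

/-- The product form `{(y, w) | ∀ j, ‖Im w_j‖ ≤ ‖Im y‖ ∧ ‖y w_j − w_j y‖ ≤ t}` (two remaining letters) is measurable. [folklore] -/
theorem measurableSet_sprod_two (t : ℝ) :
    MeasurableSet {p : ℍ × (Fin 2 → ℍ) | ∀ j : Fin 2, ‖(p.2 j).im‖ ≤ ‖p.1.im‖ ∧ ‖p.1 * p.2 j - p.2 j * p.1‖ ≤ t} := by
  have h1 : ∀ j : Fin 2, MeasurableSet {p : ℍ × (Fin 2 → ℍ) | ‖(p.2 j).im‖ ≤ ‖p.1.im‖} := fun j =>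
    measurableSet_le ((continuous_norm.comp (continuous_im.comp ((continuous_apply j).comp continuous_snd))).measurable)
      ((continuous_norm.comp (continuous_im.comp continuous_fst)).measurable)
  have h2 : ∀ j : Fin 2, MeasurableSet {p : ℍ × (Fin 2 → ℍ) | ‖p.1 * p.2 j - p.2 j * p.1‖ ≤ t} := by
    intro j
    have hc : Continuous fun p : ℍ × (Fin 2 → ℍ) => ‖p.1 * p.2 j - p.2 j * p.1‖ := by fun_prop
    exact measurableSet_le hc.measurable measurable_const
  have e : {p : ℍ × (Fin 2 → ℍ) | ∀ j : Fin 2, ‖(p.2 j).im‖ ≤ ‖p.1.im‖ ∧ ‖p.1 * p.2 j - p.2 j * p.1‖ ≤ t} =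
      ⋂ j : Fin 2, ({p : ℍ × (Fin 2 → ℍ) | ‖(p.2 j).im‖ ≤ ‖p.1.im‖} ∩ {p | ‖p.1 * p.2 j - p.2 j * p.1‖ ≤ t}) := by
    ext p
    simp only [Set.mem_setOf_eq, Set.mem_iInter, Set.mem_inter_iff]
  rw [e]
  exact MeasurableSet.iInter fun j => (h1 j).inter (h2 j)

/-- The section of the product form over `y` is the SQUARE (product over `Fin 2`) of the one-letter section. [folklore] -/
theorem mk_preimage_sprod_two (t : ℝ) (y : ℍ) :
    Prod.mk y ⁻¹' {p : ℍ × (Fin 2 → ℍ) | ∀ j : Fin 2, ‖(p.2 j).im‖ ≤ ‖p.1.im‖ ∧ ‖p.1 * p.2 j - p.2 j * p.1‖ ≤ t} =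
      Set.pi Set.univ fun _ : Fin 2 => {w : ℍ | ‖w.im‖ ≤ ‖y.im‖ ∧ ‖y * w - w * y‖ ≤ t} := by
  ext f
  simp

/-- **Fubini over the distinguished letter** (three letters): the product cone mass of the split event is `∫ (cone S_y)² dcone(y)`. [folklore] -/
theorem pi_preimage_split_eq_three (t : ℝ) (μ : Fin 3) :
    (Measure.pi fun _ : Fin 3 => coneMeasure)
        ((MeasurableEquiv.piFinSuccAbove (fun _ : Fin 3 => ℍ) μ) ⁻¹'
          {p : ℍ × (Fin 2 → ℍ) | ∀ j : Fin 2, ‖(p.2 j).im‖ ≤ ‖p.1.im‖ ∧ ‖p.1 * p.2 j - p.2 j * p.1‖ ≤ t}) =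
      ∫⁻ y, coneMeasure {w : ℍ | ‖w.im‖ ≤ ‖y.im‖ ∧ ‖y * w - w * y‖ ≤ t} ^ 2 ∂coneMeasure := by
  haveI := isProbabilityMeasure_coneMeasure
  have hS := measurableSet_sprod_two t
  rw [(measurePreserving_piFinSuccAbove (fun _ : Fin 3 => coneMeasure) μ).measure_preimage hS.nullMeasurableSet,
    Measure.prod_apply hS]
  refine lintegral_congr fun y => ?_
  rw [mk_preimage_sprod_two, Measure.pi_pi, Finset.prod_const, Finset.card_univ, Fintype.card_fin]

/-! ## §2 The commutator event in the ball model and its splitting by the largest imaginary part -/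

/-- **Pull-back** (three letters): a point of the ball model whose NORMALISED letters pairwise commute up to `t` has its letters pairwise
commuting up to `t` (normalising letters of norm `< 1` enlarges commutators, ✓`norm_comm_smul`). [folklore] -/
theorem proj_preimage_inter_ball_subset_three {t : ℝ} (ht : 0 ≤ t) :
    ((fun (x : Fin 3 → ℍ) (μ : Fin 3) => quatToSU2 (x μ)) ⁻¹'
        {C : Fin 3 → (Matrix.specialUnitaryGroup (Fin 2) ℂ) |
          ∀ μ ν : Fin 3, ‖su2Quat (C μ) * su2Quat (C ν) - su2Quat (C ν) * su2Quat (C μ)‖ ≤ t}) ∩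
      Set.pi Set.univ (fun _ : Fin 3 => Metric.ball (0 : ℍ) 1) ⊆
      {x : Fin 3 → ℍ | ∀ μ ν : Fin 3, ‖x μ * x ν - x ν * x μ‖ ≤ t} := by
  intro x hx
  simp only [Set.mem_inter_iff, Set.mem_preimage, Set.mem_setOf_eq, Set.mem_pi, Set.mem_univ, true_implies,
    Metric.mem_ball, dist_zero_right] at hx
  obtain ⟨hcomm, hball⟩ := hx
  intro μ ν
  by_cases hμ : x μ = 0
  · rw [hμ, zero_mul, mul_zero, sub_zero, norm_zero]; exact ht
  by_cases hν : x ν = 0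
  · rw [hν, zero_mul, mul_zero, sub_zero, norm_zero]; exact ht
  have h := hcomm μ ν
  rw [Literature.MathematicalPhysics.QuantumFieldTheory.Balaban1983to89.T4HaarSU2Translate.su2Quat_quatToSU2 hμ,
    Literature.MathematicalPhysics.QuantumFieldTheory.Balaban1983to89.T4HaarSU2Translate.su2Quat_quatToSU2 hν,
    norm_comm_smul, abs_of_pos (inv_pos.2 (norm_pos_iff.2 hμ)), abs_of_pos (inv_pos.2 (norm_pos_iff.2 hν))] at h
  have ha : 1 ≤ ‖x μ‖⁻¹ := (one_le_inv₀ (norm_pos_iff.2 hμ)).2 (hball μ).le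
  have hb : 1 ≤ ‖x ν‖⁻¹ := (one_le_inv₀ (norm_pos_iff.2 hν)).2 (hball ν).le
  have hab : 1 ≤ ‖x μ‖⁻¹ * ‖x ν‖⁻¹ := one_le_mul_of_one_le_of_one_le ha hb
  have hn : 0 ≤ ‖x μ * x ν - x ν * x μ‖ := norm_nonneg _
  nlinarith

/-- **Splitting by the largest imaginary part** (three letters): `G_t ⊆ ⋃_μ (split at μ)⁻¹ (product form)`. [folklore] -/
theorem commSet_subset_iUnion_three (t : ℝ) :
    {x : Fin 3 → ℍ | ∀ μ ν : Fin 3, ‖x μ * x ν - x ν * x μ‖ ≤ t} ⊆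
      ⋃ μ : Fin 3, (MeasurableEquiv.piFinSuccAbove (fun _ : Fin 3 => ℍ) μ) ⁻¹'
        {p : ℍ × (Fin 2 → ℍ) | ∀ j : Fin 2, ‖(p.2 j).im‖ ≤ ‖p.1.im‖ ∧ ‖p.1 * p.2 j - p.2 j * p.1‖ ≤ t} := by
  intro x hx
  simp only [Set.mem_setOf_eq] at hx
  obtain ⟨μ, -, hμ⟩ := Finset.exists_max_image Finset.univ (fun ν : Fin 3 => ‖(x ν).im‖) Finset.univ_nonempty
  refine Set.mem_iUnion.2 ⟨μ, ?_⟩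
  simp only [Set.mem_preimage, MeasurableEquiv.piFinSuccAbove_apply, Fin.insertNthEquiv, Equiv.coe_fn_symm_mk, Set.mem_setOf_eq,
    Fin.removeNth]
  intro j
  exact ⟨hμ _ (Finset.mem_univ _), hx μ (μ.succAbove j)⟩

/-- The product cone measure (three letters) gives full mass to the product of unit balls. [folklore] -/
theorem pi_coneMeasure_compl_piBall_three :
    (Measure.pi fun _ : Fin 3 => coneMeasure) (Set.pi Set.univ (fun _ : Fin 3 => Metric.ball (0 : ℍ) 1))ᶜ = 0 := by
  haveI := isProbabilityMeasure_coneMeasure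
  have hball : coneMeasure (Metric.ball (0 : ℍ) 1) = 1 := by
    rw [coneMeasure_apply measurableSet_ball subset_rfl, ENNReal.inv_mul_cancel volume_ball_quat_ne_zero volume_ball_quat_ne_top]
  have h1 : (Measure.pi fun _ : Fin 3 => coneMeasure) (Set.pi Set.univ (fun _ : Fin 3 => Metric.ball (0 : ℍ) 1)) = 1 := by
    rw [Measure.pi_pi]; simp [hball]
  rw [measure_compl (MeasurableSet.univ_pi fun _ => measurableSet_ball) (measure_ne_top _ _), h1, measure_univ, tsub_self]

/-- ★ **Haar mass ≤ sum over the distinguished letter of the shell integrals** (three letters, square). [folklore] -/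
theorem haar_pi_le_sum_lintegral_three {t : ℝ} (ht : 0 ≤ t) :
    (Measure.pi fun _ : Fin 3 => haarProbability (Matrix.specialUnitaryGroup (Fin 2) ℂ))
        {C : Fin 3 → (Matrix.specialUnitaryGroup (Fin 2) ℂ) |
          ∀ μ ν : Fin 3, ‖su2Quat (C μ) * su2Quat (C ν) - su2Quat (C ν) * su2Quat (C μ)‖ ≤ t} ≤
      ∑ _μ : Fin 3, ∫⁻ y, coneMeasure {w : ℍ | ‖w.im‖ ≤ ‖y.im‖ ∧ ‖y * w - w * y‖ ≤ t} ^ 2 ∂coneMeasure := by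
  have hE := measurableSet_nearlyCommuting_three t
  rw [← measurePreserving_proj_three.measure_preimage hE.nullMeasurableSet]
  set P := (fun (x : Fin 3 → ℍ) (μ : Fin 3) => quatToSU2 (x μ)) ⁻¹'
    {C : Fin 3 → (Matrix.specialUnitaryGroup (Fin 2) ℂ) |
      ∀ μ ν : Fin 3, ‖su2Quat (C μ) * su2Quat (C ν) - su2Quat (C ν) * su2Quat (C μ)‖ ≤ t} with hP
  set B := Set.pi Set.univ (fun _ : Fin 3 => Metric.ball (0 : ℍ) 1) with hB
  calc (Measure.pi fun _ : Fin 3 => coneMeasure) P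
      ≤ (Measure.pi fun _ : Fin 3 => coneMeasure) (P ∩ B ∪ Bᶜ) := measure_mono (fun x hx => by
          by_cases hb : x ∈ B
          · exact Or.inl ⟨hx, hb⟩
          · exact Or.inr hb)
    _ ≤ (Measure.pi fun _ : Fin 3 => coneMeasure) (P ∩ B) + (Measure.pi fun _ : Fin 3 => coneMeasure) Bᶜ := measure_union_le _ _
    _ = (Measure.pi fun _ : Fin 3 => coneMeasure) (P ∩ B) := by rw [pi_coneMeasure_compl_piBall_three, add_zero]
    _ ≤ (Measure.pi fun _ : Fin 3 => coneMeasure) (⋃ μ : Fin 3, (MeasurableEquiv.piFinSuccAbove (fun _ : Fin 3 => ℍ) μ) ⁻¹'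
          {p : ℍ × (Fin 2 → ℍ) | ∀ j : Fin 2, ‖(p.2 j).im‖ ≤ ‖p.1.im‖ ∧ ‖p.1 * p.2 j - p.2 j * p.1‖ ≤ t}) :=
        measure_mono ((proj_preimage_inter_ball_subset_three ht).trans (commSet_subset_iUnion_three t))
    _ ≤ ∑ μ : Fin 3, (Measure.pi fun _ : Fin 3 => coneMeasure) ((MeasurableEquiv.piFinSuccAbove (fun _ : Fin 3 => ℍ) μ) ⁻¹'
          {p : ℍ × (Fin 2 → ℍ) | ∀ j : Fin 2, ‖(p.2 j).im‖ ≤ ‖p.1.im‖ ∧ ‖p.1 * p.2 j - p.2 j * p.1‖ ≤ t}) :=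
        measure_iUnion_fintype_le _ _
    _ = ∑ _μ : Fin 3, ∫⁻ y, coneMeasure {w : ℍ | ‖w.im‖ ≤ ‖y.im‖ ∧ ‖y * w - w * y‖ ≤ t} ^ 2 ∂coneMeasure :=
        Finset.sum_congr rfl fun μ _ => pi_preimage_split_eq_three t μ

/-! ## §3 The dyadic shell bound for the squared integrand — a geometric series, no logarithm -/

/-- ★ **Pointwise shell bound** (square): with `a_k = (c·4t²·2^{k+1})²`,
`(cone S_y)² ≤ Σ_{k ≤ K} a_k·𝟙{2^{-(k+1)} < ‖Im y‖ ≤ 2^{-k}} + 𝟙{‖Im y‖ ≤ 2^{-(K+1)}} + 𝟙{1 < ‖Im y‖}`. [folklore] -/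
theorem integrand_sq_le_shellSum {t : ℝ} (ht : 0 ≤ t) (K : ℕ) (y : ℍ) :
    coneMeasure {w : ℍ | ‖w.im‖ ≤ ‖y.im‖ ∧ ‖y * w - w * y‖ ≤ t} ^ 2 ≤
      (∑ k ∈ Finset.range (K + 1),
          {z : ℍ | (1 / 2 : ℝ) ^ (k + 1) < ‖z.im‖ ∧ ‖z.im‖ ≤ (1 / 2) ^ k}.indicator
            (fun _ => ENNReal.ofReal ((coneConst * (4 * t ^ 2 * 2 ^ (k + 1))) ^ 2)) y) +
        {z : ℍ | ‖z.im‖ ≤ (1 / 2 : ℝ) ^ (K + 1)}.indicator (fun _ => (1 : ℝ≥0∞)) y +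
        {z : ℍ | 1 < ‖z.im‖}.indicator (fun _ => (1 : ℝ≥0∞)) y := by
  have h1 : coneMeasure {w : ℍ | ‖w.im‖ ≤ ‖y.im‖ ∧ ‖y * w - w * y‖ ≤ t} ^ 2 ≤ 1 := by
    calc coneMeasure {w : ℍ | ‖w.im‖ ≤ ‖y.im‖ ∧ ‖y * w - w * y‖ ≤ t} ^ 2 ≤ 1 ^ 2 := by
          gcongr; exact coneMeasure_le_one _
      _ = 1 := one_pow 2
  by_cases htop : 1 < ‖y.im‖
  · have : {z : ℍ | 1 < ‖z.im‖}.indicator (fun _ => (1 : ℝ≥0∞)) y = 1 := Set.indicator_of_mem (by exact htop) _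
    rw [this]
    exact h1.trans (le_add_self)
  by_cases hbot : ‖y.im‖ ≤ (1 / 2 : ℝ) ^ (K + 1)
  · have : {z : ℍ | ‖z.im‖ ≤ (1 / 2 : ℝ) ^ (K + 1)}.indicator (fun _ => (1 : ℝ≥0∞)) y = 1 := Set.indicator_of_mem (by exact hbot) _
    rw [this]
    exact h1.trans (le_add_right le_add_self)
  -- the dyadic shell of `‖Im y‖`
  obtain ⟨k, hk, hlo, hhi⟩ := exists_shell (not_lt.1 htop) (not_le.1 hbot)
  have hm : 0 < ‖y.im‖ := lt_trans (by positivity) hlo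
  have hy : y.im ≠ 0 := norm_pos_iff.1 hm
  have hsec := coneMeasure_section_le ht hy
  have hterm : coneMeasure {w : ℍ | ‖w.im‖ ≤ ‖y.im‖ ∧ ‖y * w - w * y‖ ≤ t} ^ 2 ≤
      ENNReal.ofReal ((coneConst * (4 * t ^ 2 * 2 ^ (k + 1))) ^ 2) := by
    have hc := coneConst_pos
    have hle : coneConst * (4 * t ^ 2 / ‖y.im‖) ≤ coneConst * (4 * t ^ 2 * 2 ^ (k + 1)) := by
      refine mul_le_mul_of_nonneg_left ?_ hc.le
      rw [div_le_iff₀ hm]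
      have h2 : (1 : ℝ) < 2 ^ (k + 1) * ‖y.im‖ := by
        rw [one_div, inv_pow] at hlo
        have := (inv_lt_iff_one_lt_mul₀ (by positivity)).1 hlo
        linarith
      nlinarith [sq_nonneg t]
    calc coneMeasure {w : ℍ | ‖w.im‖ ≤ ‖y.im‖ ∧ ‖y * w - w * y‖ ≤ t} ^ 2
        ≤ (ENNReal.ofReal (coneConst * (4 * t ^ 2 * 2 ^ (k + 1)))) ^ 2 := by
          gcongr
          exact hsec.trans (ENNReal.ofReal_le_ofReal hle)
      _ = ENNReal.ofReal ((coneConst * (4 * t ^ 2 * 2 ^ (k + 1))) ^ 2) := by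
          rw [ENNReal.ofReal_pow (by positivity)]
  have hind : {z : ℍ | (1 / 2 : ℝ) ^ (k + 1) < ‖z.im‖ ∧ ‖z.im‖ ≤ (1 / 2) ^ k}.indicator
      (fun _ => ENNReal.ofReal ((coneConst * (4 * t ^ 2 * 2 ^ (k + 1))) ^ 2)) y =
        ENNReal.ofReal ((coneConst * (4 * t ^ 2 * 2 ^ (k + 1))) ^ 2) := Set.indicator_of_mem (by exact ⟨hlo, hhi⟩) _
  have hsum : ENNReal.ofReal ((coneConst * (4 * t ^ 2 * 2 ^ (k + 1))) ^ 2) ≤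
      ∑ k ∈ Finset.range (K + 1), {z : ℍ | (1 / 2 : ℝ) ^ (k + 1) < ‖z.im‖ ∧ ‖z.im‖ ≤ (1 / 2) ^ k}.indicator
        (fun _ => ENNReal.ofReal ((coneConst * (4 * t ^ 2 * 2 ^ (k + 1))) ^ 2)) y := by
    rw [← hind]
    exact Finset.single_le_sum (f := fun k => {z : ℍ | (1 / 2 : ℝ) ^ (k + 1) < ‖z.im‖ ∧ ‖z.im‖ ≤ (1 / 2) ^ k}.indicator
        (fun _ => ENNReal.ofReal ((coneConst * (4 * t ^ 2 * 2 ^ (k + 1))) ^ 2)) y) (fun _ _ => zero_le) hk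
  exact (hterm.trans hsum).trans (le_trans le_self_add le_self_add)

/-- ★ **The shell integral, squared integrand**: `∫ (cone S_y)² dcone(y) ≤ 2048c³t⁴ + 16c·2^{-3(K+1)}` for EVERY `K` — the shell terms
`(c·4t²·2^{k+1})²·16c·2^{-3k} = 1024c³t⁴·2^{-k}` form a geometric series (the three-letter block has no logarithm). [folklore] -/
theorem lintegral_integrand_sq_le {t : ℝ} (ht : 0 ≤ t) (K : ℕ) :
    ∫⁻ y, coneMeasure {w : ℍ | ‖w.im‖ ≤ ‖y.im‖ ∧ ‖y * w - w * y‖ ≤ t} ^ 2 ∂coneMeasure ≤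
      ENNReal.ofReal (2048 * coneConst ^ 3 * t ^ 4 + coneConst * (16 * ((1 / 2 : ℝ) ^ (K + 1)) ^ 3)) := by
  have hc := coneConst_pos
  -- integrate the shell bound
  refine (lintegral_mono fun y => integrand_sq_le_shellSum ht K y).trans ?_
  have E := lintegral_shellSum_eq coneMeasure (fun k => {z : ℍ | (1 / 2 : ℝ) ^ (k + 1) < ‖z.im‖ ∧ ‖z.im‖ ≤ (1 / 2) ^ k})
    measurableSet_shell (fun k => ENNReal.ofReal ((coneConst * (4 * t ^ 2 * 2 ^ (k + 1))) ^ 2)) {z : ℍ | ‖z.im‖ ≤ (1 / 2 : ℝ) ^ (K + 1)}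
    {z : ℍ | 1 < ‖z.im‖} (measurableSet_imBall _) (measurableSet_imBall_compl _) K
  refine (le_of_eq E).trans ?_
  rw [coneMeasure_imBall_compl_one, add_zero]
  -- the `k`-th shell term is `≤ 1024 c³ t⁴ (1/2)^k`
  have hterm : ∀ k ∈ Finset.range (K + 1),
      ENNReal.ofReal ((coneConst * (4 * t ^ 2 * 2 ^ (k + 1))) ^ 2) *
          coneMeasure {z : ℍ | (1 / 2 : ℝ) ^ (k + 1) < ‖z.im‖ ∧ ‖z.im‖ ≤ (1 / 2) ^ k} ≤
        ENNReal.ofReal (1024 * coneConst ^ 3 * t ^ 4 * (1 / 2 : ℝ) ^ k) := by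
    intro k _
    calc ENNReal.ofReal ((coneConst * (4 * t ^ 2 * 2 ^ (k + 1))) ^ 2) *
          coneMeasure {z : ℍ | (1 / 2 : ℝ) ^ (k + 1) < ‖z.im‖ ∧ ‖z.im‖ ≤ (1 / 2) ^ k}
        ≤ ENNReal.ofReal ((coneConst * (4 * t ^ 2 * 2 ^ (k + 1))) ^ 2) * ENNReal.ofReal (coneConst * (16 * ((1 / 2 : ℝ) ^ k) ^ 3)) :=
          mul_le_mul_right (coneMeasure_shell_le k) _
      _ = ENNReal.ofReal (1024 * coneConst ^ 3 * t ^ 4 * (1 / 2 : ℝ) ^ k) := by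
          rw [← ENNReal.ofReal_mul (by positivity)]
          congr 1
          have h2 : (2 : ℝ) ^ (k + 1) * (1 / 2) ^ k = 2 := by
            rw [pow_succ, one_div, inv_pow, mul_assoc, mul_comm (2 : ℝ) _, ← mul_assoc, mul_inv_cancel₀ (by positivity), one_mul]
          calc (coneConst * (4 * t ^ 2 * 2 ^ (k + 1))) ^ 2 * (coneConst * (16 * ((1 / 2 : ℝ) ^ k) ^ 3))
              = 256 * coneConst ^ 3 * t ^ 4 * ((2 : ℝ) ^ (k + 1) * (1 / 2) ^ k) ^ 2 * (1 / 2 : ℝ) ^ k := by ring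
            _ = 1024 * coneConst ^ 3 * t ^ 4 * (1 / 2 : ℝ) ^ k := by rw [h2]; ring
  have hsum := Finset.sum_le_sum hterm
  -- the geometric series `Σ_{k ≤ K} (1/2)^k ≤ 2`
  have hgeom : ∑ k ∈ Finset.range (K + 1), ENNReal.ofReal (1024 * coneConst ^ 3 * t ^ 4 * (1 / 2 : ℝ) ^ k) ≤
      ENNReal.ofReal (2048 * coneConst ^ 3 * t ^ 4) := by
    rw [← ENNReal.ofReal_sum_of_nonneg (fun k _ => by positivity)]
    refine ENNReal.ofReal_le_ofReal ?_
    rw [← Finset.mul_sum]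
    have hg := sum_geometric_two_le (K + 1)
    have h0 : 0 ≤ 1024 * coneConst ^ 3 * t ^ 4 := by positivity
    calc 1024 * coneConst ^ 3 * t ^ 4 * ∑ k ∈ Finset.range (K + 1), (1 / 2 : ℝ) ^ k
        ≤ 1024 * coneConst ^ 3 * t ^ 4 * 2 := mul_le_mul_of_nonneg_left hg h0
      _ = 2048 * coneConst ^ 3 * t ^ 4 := by ring
  have hB : coneMeasure {z : ℍ | ‖z.im‖ ≤ (1 / 2 : ℝ) ^ (K + 1)} ≤ ENNReal.ofReal (coneConst * (16 * ((1 / 2 : ℝ) ^ (K + 1)) ^ 3)) :=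
    coneMeasure_imBall_le (by positivity)
  calc (∑ k ∈ Finset.range (K + 1), ENNReal.ofReal ((coneConst * (4 * t ^ 2 * 2 ^ (k + 1))) ^ 2) *
          coneMeasure {z : ℍ | (1 / 2 : ℝ) ^ (k + 1) < ‖z.im‖ ∧ ‖z.im‖ ≤ (1 / 2) ^ k}) +
        coneMeasure {z : ℍ | ‖z.im‖ ≤ (1 / 2 : ℝ) ^ (K + 1)}
      ≤ ENNReal.ofReal (2048 * coneConst ^ 3 * t ^ 4) +
          ENNReal.ofReal (coneConst * (16 * ((1 / 2 : ℝ) ^ (K + 1)) ^ 3)) := add_le_add (hsum.trans hgeom) hB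
    _ = ENNReal.ofReal (2048 * coneConst ^ 3 * t ^ 4 + coneConst * (16 * ((1 / 2 : ℝ) ^ (K + 1)) ^ 3)) := by
        rw [ENNReal.ofReal_add (by positivity) (by positivity)]

/-! ## §4 The three-letter ceiling -/

/-- ★★ **THE THREE-LETTER CEILING (no logarithm).**  There are `C > 0` and `t₀ > 0` (here `t₀ = 1/2`,
`C = 3·(2048·c³ + 16·c)`, `c = vol(B⁴)⁻¹ = 2/π²`) such that for `0 < t ≤ t₀` the product Haar measure of the TRIPLES
`(C_μ) ∈ SU(2)³` whose unit quaternions pairwise commute up to `t`, `‖q(C_μ)q(C_ν) − q(C_ν)q(C_μ)‖ ≤ t` for all `μ, ν`, is AT MOST `C·t⁴`.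
The zero-mode block of the swap-glued femto ring at a swap-central flat point (cone of commuting triples): pole `2`, multiplicity `1` — no
`log`, in contrast with the four-letter block `≍ t⁶·log(1/t)` of the periodic ring (✓`haar_pi_nearlyCommuting_two_sided`). [folklore] -/
theorem haar_pi_nearlyCommuting_three_le :
    ∃ C : ℝ, 0 < C ∧ ∃ t₀ : ℝ, 0 < t₀ ∧ ∀ t : ℝ, 0 < t → t ≤ t₀ →
      (Measure.pi fun _ : Fin 3 => haarProbability (Matrix.specialUnitaryGroup (Fin 2) ℂ)).real
          {C : Fin 3 → (Matrix.specialUnitaryGroup (Fin 2) ℂ) |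
            ∀ μ ν : Fin 3, ‖su2Quat (C μ) * su2Quat (C ν) - su2Quat (C ν) * su2Quat (C μ)‖ ≤ t} ≤
        C * t ^ 4 := by
  have hc := coneConst_pos
  refine ⟨3 * (2048 * coneConst ^ 3 + 16 * coneConst), by positivity, 1 / 2, by norm_num, fun t ht ht₀ => ?_⟩
  -- the number of shells: `2^K ≤ t⁻² < 2^{K+1}` (any `K` with `2^{-(K+1)} ≤ t²` would do — the series is geometric)
  have ht1 : t ≤ 1 := by linarith
  have hX1 : (1 : ℝ) ≤ (t ^ 2)⁻¹ := (one_le_inv₀ (by positivity)).2 (by nlinarith)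
  obtain ⟨K, -, hK2⟩ := exists_nat_pow_near hX1 (by norm_num : (1 : ℝ) < 2)
  -- the tail shell: `2^{-(K+1)} ≤ t²`, so the core costs `≤ 16c·t⁶ ≤ 16c·t⁴`
  have htail : ((1 / 2 : ℝ) ^ (K + 1)) ^ 3 ≤ t ^ 4 := by
    have h1 : (1 / 2 : ℝ) ^ (K + 1) ≤ t ^ 2 := by
      rw [one_div, inv_pow]
      exact (inv_le_comm₀ (by positivity) (by positivity)).1 hK2.le
    calc ((1 / 2 : ℝ) ^ (K + 1)) ^ 3 ≤ (t ^ 2) ^ 3 := pow_le_pow_left₀ (by positivity) h1 3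
      _ = t ^ 4 * t ^ 2 := by ring
      _ ≤ t ^ 4 * 1 := mul_le_mul_of_nonneg_left (by nlinarith) (by positivity)
      _ = t ^ 4 := mul_one _
  -- the bound in `ℝ≥0∞`
  have hmain := haar_pi_le_sum_lintegral_three ht.le
  have hI := lintegral_integrand_sq_le ht.le K
  have hfin : (Measure.pi fun _ : Fin 3 => haarProbability (Matrix.specialUnitaryGroup (Fin 2) ℂ))
      {C : Fin 3 → (Matrix.specialUnitaryGroup (Fin 2) ℂ) |
        ∀ μ ν : Fin 3, ‖su2Quat (C μ) * su2Quat (C ν) - su2Quat (C ν) * su2Quat (C μ)‖ ≤ t} ≠ ∞ :=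
    measure_ne_top _ _
  set R : ℝ := 2048 * coneConst ^ 3 * t ^ 4 + coneConst * (16 * ((1 / 2 : ℝ) ^ (K + 1)) ^ 3) with hR
  have hR0 : 0 ≤ R := by positivity
  have h3 : (Measure.pi fun _ : Fin 3 => haarProbability (Matrix.specialUnitaryGroup (Fin 2) ℂ))
      {C : Fin 3 → (Matrix.specialUnitaryGroup (Fin 2) ℂ) |
        ∀ μ ν : Fin 3, ‖su2Quat (C μ) * su2Quat (C ν) - su2Quat (C ν) * su2Quat (C μ)‖ ≤ t} ≤
      ENNReal.ofReal (3 * R) := by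
    refine hmain.trans ?_
    rw [Finset.sum_const, Finset.card_univ, Fintype.card_fin, nsmul_eq_mul, show (3 : ℝ) * R = ((3 : ℕ) : ℝ) * R by norm_num,
      ENNReal.ofReal_mul (by positivity), ENNReal.ofReal_natCast]
    exact mul_le_mul_right hI _
  have hreal : ((Measure.pi fun _ : Fin 3 => haarProbability (Matrix.specialUnitaryGroup (Fin 2) ℂ))
      {C : Fin 3 → (Matrix.specialUnitaryGroup (Fin 2) ℂ) |
        ∀ μ ν : Fin 3, ‖su2Quat (C μ) * su2Quat (C ν) - su2Quat (C ν) * su2Quat (C μ)‖ ≤ t}).toReal ≤ 3 * R :=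
    ENNReal.toReal_le_of_le_ofReal (by positivity) h3
  show ((Measure.pi fun _ : Fin 3 => haarProbability (Matrix.specialUnitaryGroup (Fin 2) ℂ))
      {C : Fin 3 → (Matrix.specialUnitaryGroup (Fin 2) ℂ) |
        ∀ μ ν : Fin 3, ‖su2Quat (C μ) * su2Quat (C ν) - su2Quat (C ν) * su2Quat (C μ)‖ ≤ t}).toReal ≤ _
  refine hreal.trans ?_
  -- `3R ≤ C t⁴`
  have h2 : coneConst * (16 * ((1 / 2 : ℝ) ^ (K + 1)) ^ 3) ≤ 16 * coneConst * t ^ 4 := by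
    calc coneConst * (16 * ((1 / 2 : ℝ) ^ (K + 1)) ^ 3) ≤ coneConst * (16 * t ^ 4) := by gcongr
      _ = 16 * coneConst * t ^ 4 := by ring
  have e : 3 * (2048 * coneConst ^ 3 + 16 * coneConst) * t ^ 4 = 3 * (2048 * coneConst ^ 3 * t ^ 4 + 16 * coneConst * t ^ 4) := by
    ring
  rw [e, hR]
  linarith

end Summit.QuantumFields.YangMills.Theorems.SwapVirialDeficit.NearlyCommutingThree

end
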